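import Literature.NumberTheory.Sieve.SmoothTypeOne
import Literature.NumberTheory.Sieve.TypeTwoBound
import HarnessLib

/-!
# The core of the smooth Bombieri–Vinogradov estimate over totally real fields (Hinz 1988, §4)

Topic `Literature/NumberTheory/Sieve`, sub-namespace `SmoothBVCore`. For a smooth cube weight
`Ω(α) = ∏_w k(log σ_wα − log M)` and a character `χ mod 𝔣` put
`ψ_Ω(χ) = ∑_{α ∈ A₀(M)} Ω(α) χ(α) Λ((α))`. Vaughan's identity
(`NumberFieldVaughan.sum_mul_vonMangoldt_eq_complex` with `w = Ω·χ`) splits `ψ_Ω(χ)` into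
`S₁ − S₂ + S₃ − S₄` with `S₂ = SmoothTypeOne.S2`, `S₃ = SmoothTypeOne.S3`, `S₄ = TypeTwoBound.S4total`
(`psi_eq`), and `S₁` is trivially small (`norm_S1_le`). Summing the three bounds
`SmoothTypeOne.typeOne_bound`, `TypeTwoBound.typeII_bound` and the trivial one over the moduli
`Q₁ < N𝔣 ≤ Q` with the weights `(1/φ(𝔣)) ∑*_χ` gives the **core mean value estimate**
`smoothBV_core` — Hinz's (2.3) for the smoothly weighted prime sums, with every constant explicit
in `M, U, Q₁, Q` and in the profile data (`sup|k|`, `‖k̂‖₁`, the Fourier-decay constant `G` of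
`k(log r)` and `(log r) k(log r)`):

`∑_{Q₁<N𝔣≤Q} (1/φ(𝔣)) ∑*_χ |ψ_Ω(χ)| ≤ C [ K_∞^d (1+log M)^{r} Q U log U · #I(U)`
`   + G^d/M^d (U² log U #I(U)² + (d log M + log U + d) U #I(U)) Q² #I(Q)`
`   + ‖k̂‖₁^d (log M)^{r+3} √(H(U)³) (Q M^{d/2} + M^d/√U + M^d/Q₁) ]`

(`#I(x) = #idealsLE x ≤ C_K x`). With `U = Q₁ = (log M)^B'`, `Q = M^{d/2}(log M)^{-B''}` every
term is `≪ M^d (log M)^{-B}`.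

## References

* J. Hinz, Acta Arith. 51 (1988), §2 (2.3) and §4. [cite: Hinz1988, §2 (2.3), §4]
-/

noncomputable section

open Finset NumberField NumberField.InfinitePlace MeasureTheory
  Literature.NumberTheory.Sieve.NumberFieldLS Literature.NumberTheory.Sieve.BoxPrimes
  Literature.NumberTheory.Sieve.NumberFieldVaughan Literature.NumberTheory.Sieve.MitsuiPNT
  Literature.NumberTheory.LFunctions Literature.NumberTheory.LFunctions.NumberField
  Literature.NumberTheory.Sieve.CastilloEtAl2015 Literature.NumberTheory.Sieve.TypeTwoReparam
  Literature.NumberTheory.Sieve.TypeTwoCoeff Literature.NumberTheory.Sieve.TypeTwoBlock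
  Literature.NumberTheory.Sieve.TypeTwoBound Literature.NumberTheory.Sieve.SmoothTypeOne
  Literature.NumberTheory.Sieve.PrimRed Literature.NumberTheory.Sieve.SmoothCoset
  Literature.NumberTheory.Sieve.SmoothWeights
open scoped Classical FourierTransform

namespace Literature.NumberTheory.Sieve.SmoothBVCore

variable {K : Type*} [Field K] [NumberField K] [IsTotallyReal K]

local notation "d" => Module.finrank ℚ K
local notation "RP" => {w : InfinitePlace K // IsReal w}
local notation "rk" => Module.finrank ℝ (NumberField.Units.dirichletUnitTheorem.logSpace K)

/-! ## `ψ_Ω(χ)` and Vaughan's decomposition -/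

variable (K) in
/-- `ψ_Ω(χ) = ∑_{α ∈ A₀(M)} Ω(α) χ(α) Λ((α))`. [cite: Hinz1988, §2 (2.3)] -/
def psiΩ {𝔣 : Ideal (𝓞 K)} (χ : AddChar (Additive ((𝓞 K ⧸ 𝔣)ˣ)) ℂ) (k : ℝ → ℝ) (M : ℝ) : ℂ :=
  ∑ α ∈ cubeF K M, weightΩ K (fun v => (k v : ℂ)) M α * unitValue χ (Ideal.Quotient.mk 𝔣 α) *
    (idealVonMangoldt (Ideal.span {α}) : ℂ)

variable (K) in
/-- `S₁(χ) = ∑_{α ∈ A₀(M), N(α) ≤ U} Ω(α) χ(α) Λ((α))`. [cite: Hinz1988, §4 p. 185 (S₁)] -/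
def S1 {𝔣 : Ideal (𝓞 K)} (χ : AddChar (Additive ((𝓞 K ⧸ 𝔣)ˣ)) ℂ) (k : ℝ → ℝ) (M U : ℝ) : ℂ :=
  ∑ α ∈ cubeF K M, weightΩ K (fun v => (k v : ℂ)) M α * unitValue χ (Ideal.Quotient.mk 𝔣 α) *
    (vA1 K U (Ideal.span {α}) : ℂ)

/-- **Vaughan's decomposition of `ψ_Ω(χ)`**: `ψ_Ω = S₁ − S₂ + S₃ − S₄`.
[cite: Hinz1988, §4 (4.1)–(4.4)] -/
theorem psi_eq {𝔣 : Ideal (𝓞 K)} (χ : AddChar (Additive ((𝓞 K ⧸ 𝔣)ˣ)) ℂ) (k : ℝ → ℝ) (M : ℝ) {U : ℝ}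
    (hU : 1 ≤ U) :
    psiΩ K χ k M = S1 K χ k M U - SmoothTypeOne.S2 K χ k M U + SmoothTypeOne.S3 K χ k M U - S4total K χ (fun v => (k v : ℂ)) M U := by
  have hB : ∀ α ∈ cubeF K M, α ≠ 0 := fun α hα => ne_zero_of_mem_box₀ (mem_cubeF.1 hα)
  have hX : ∀ α ∈ cubeF K M, |(Algebra.norm ℚ (α : K) : ℝ)| ≤ M ^ d := by
    intro α hα
    obtain ⟨_, _, h2⟩ := span_mem_idealFamily (K := K) (mem_cubeF.1 hα)
    rwa [absNorm_span_eq_abs_norm] at h2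
  have h := sum_mul_vonMangoldt_eq_complex hU (cubeF K M) hB hX
    (fun α => weightΩ K (fun v => (k v : ℂ)) M α * unitValue χ (Ideal.Quotient.mk 𝔣 α))
  unfold psiΩ S1 SmoothTypeOne.S2 SmoothTypeOne.S3 S4total S4block
  rw [h]

/-! ## The trivial bound for `S₁` -/

/-- `|Ω(α)| ≤ K_∞^d` when `|k| ≤ K_∞`. [folklore] -/
theorem norm_weightΩ_le {k : ℝ → ℝ} {Kmax : ℝ} (hK : ∀ v, |k v| ≤ Kmax) (M : ℝ) (α : 𝓞 K) :
    ‖weightΩ K (fun v => (k v : ℂ)) M α‖ ≤ Kmax ^ d := by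
  unfold weightΩ
  rw [norm_prod]
  calc ∏ w : RP, ‖((k (Real.log (remb K (α : K) w) - Real.log M) : ℝ) : ℂ)‖ ≤ ∏ _w : RP, Kmax :=
        Finset.prod_le_prod (fun _ _ => norm_nonneg _) fun w _ => by
          rw [Complex.norm_real, Real.norm_eq_abs]; exact hK _
    _ = Kmax ^ d := by rw [Finset.prod_const, Finset.card_univ, SmoothCoset.card_RP_eq]

/-- **`|S₁(χ)| ≤ K_∞^d C_g (1 + log M)^{r} log U · #idealsLE U`** (`M, U ≥ 1`).
[cite: Hinz1988, §4 p. 185 (S₁)] -/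
theorem norm_S1_le {k : ℝ → ℝ} {Kmax : ℝ} (hK : ∀ v, |k v| ≤ Kmax) {Cg : ℝ} (hCg0 : 0 ≤ Cg)
    (hCg : ∀ X : ℝ, 1 ≤ X → ∀ I : Ideal (𝓞 K),
      (Nat.card {α : 𝓞 K // α ∈ box₀ K X ∧ Ideal.span {α} = I} : ℝ) ≤ Cg * (1 + Real.log X) ^ rk)
    {M U : ℝ} (hM : 1 ≤ M) (hU : 1 ≤ U) {𝔣 : Ideal (𝓞 K)} (h𝔣 : 𝔣 ≠ ⊥) (χ : AddChar (Additive ((𝓞 K ⧸ 𝔣)ˣ)) ℂ) :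
    ‖S1 K χ k M U‖ ≤ Kmax ^ d * (Cg * (1 + Real.log M) ^ rk * (Real.log U * (idealsLE K U).card)) := by
  have hKmax : 0 ≤ Kmax := le_trans (abs_nonneg _) (hK 0)
  haveI : Finite (𝓞 K ⧸ 𝔣) := Ideal.finiteQuotientOfFreeOfNeBot 𝔣 h𝔣
  unfold S1
  -- termwise: `|Ω χ a₁| ≤ K^d · Λ_≤((α))`
  have hterm : ∀ α ∈ cubeF K M, ‖weightΩ K (fun v => (k v : ℂ)) M α * unitValue χ (Ideal.Quotient.mk 𝔣 α) *
      (vA1 K U (Ideal.span {α}) : ℂ)‖ ≤ Kmax ^ d * lamLE K U (Ideal.span {α}) := by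
    intro α _
    have hlam : 0 ≤ lamLE K U (Ideal.span {α}) := by
      unfold lamLE; split_ifs
      · exact idealVonMangoldt_nonneg _
      · exact le_rfl
    rw [norm_mul, norm_mul, show vA1 K U (Ideal.span {α}) = lamLE K U (Ideal.span {α}) from rfl,
      Complex.norm_real, Real.norm_eq_abs, abs_of_nonneg hlam]
    calc ‖weightΩ K (fun v => (k v : ℂ)) M α‖ * ‖unitValue χ (Ideal.Quotient.mk 𝔣 α)‖ * lamLE K U (Ideal.span {α})
        ≤ Kmax ^ d * 1 * lamLE K U (Ideal.span {α}) :=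
          mul_le_mul_of_nonneg_right (mul_le_mul (norm_weightΩ_le hK M α) (norm_unitValue_le χ _)
            (norm_nonneg _) (pow_nonneg hKmax _)) hlam
      _ = _ := by ring
  refine (norm_sum_le _ _).trans ((Finset.sum_le_sum hterm).trans ?_)
  rw [← Finset.mul_sum]
  refine mul_le_mul_of_nonneg_left ?_ (pow_nonneg hKmax _)
  -- through the ideals
  have hlam0 : ∀ 𝔞, 0 ≤ lamLE K U 𝔞 := fun 𝔞 => by
    unfold lamLE; split_ifs
    · exact idealVonMangoldt_nonneg _
    · exact le_rfl
  have h1 := sum_box₀_le_mul_sum_ideals (K := K) hCg0 hCg hM (cubeF K M) (fun α hα => mem_cubeF.1 hα)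
    (lamLE K U) hlam0
  refine h1.trans (mul_le_mul_of_nonneg_left ?_ (by have := Real.log_nonneg hM; positivity))
  -- `∑_{N𝔞 ≤ M^d} Λ_≤(𝔞) ≤ ∑_{N𝔞 ≤ U} Λ(𝔞) ≤ log U · #idealsLE U`
  have hlogU := Real.log_nonneg hU
  calc ∑ 𝔞 ∈ idealsLE K (M ^ d), lamLE K U 𝔞
      = ∑ 𝔞 ∈ (idealsLE K (M ^ d)).filter (fun 𝔞 => (Ideal.absNorm 𝔞 : ℝ) ≤ U), idealVonMangoldt 𝔞 := by
        rw [Finset.sum_filter]; rfl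
    _ ≤ ∑ 𝔞 ∈ idealsLE K U, idealVonMangoldt 𝔞 := by
        refine Finset.sum_le_sum_of_subset_of_nonneg (fun 𝔞 h𝔞 => ?_) fun _ _ _ => idealVonMangoldt_nonneg _
        rw [Finset.mem_filter, mem_idealsLE] at h𝔞
        rw [mem_idealsLE]; exact ⟨h𝔞.1.1, h𝔞.2⟩
    _ ≤ ∑ _𝔞 ∈ idealsLE K U, Real.log U := Finset.sum_le_sum fun 𝔞 h𝔞 => by
        obtain ⟨h0, hle⟩ := mem_idealsLE.1 h𝔞
        exact (idealVonMangoldt_le_log h0).trans (Real.log_le_log (absNorm_pos_of_ne_bot h0) hle)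
    _ = Real.log U * (idealsLE K U).card := by rw [Finset.sum_const, nsmul_eq_mul, mul_comm]

/-! ## The core estimate -/

set_option maxHeartbeats 800000 in
-- the assembly threads the type I, type II and trivial bounds with their constants at once
/-- **The core smooth Bombieri–Vinogradov estimate** (see the file docstring): the three bounds
summed over `Q₁ < N𝔣 ≤ Q` with `(1/φ(𝔣)) ∑*_χ`. [cite: Hinz1988, §2 (2.3), §4] -/
theorem smoothBV_core : ∃ C : ℝ, 0 < C ∧
    ∀ (k : ℝ → ℝ), (∀ v, 0 ≤ v → k v = 0) → ContDiff ℝ 2 (fun v => (k v : ℂ)) →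
      HasCompactSupport (fun v => (k v : ℂ)) → ContDiff ℝ 3 (gOfC k) → HasCompactSupport (gOfC k) →
      ContDiff ℝ 3 (gOfC fun v => v * k v) → HasCompactSupport (gOfC fun v => v * k v) →
    ∀ (Kmax G : ℝ), (∀ v, |k v| ≤ Kmax) → 0 ≤ G → (∀ τ, ‖𝓕 (gOfC k) τ‖ ≤ G * dec 3 τ) →
      (∀ τ, ‖𝓕 (gOfC fun v => v * k v) τ‖ ≤ G * dec 3 τ) →
    ∀ (M U Q₁ Q : ℝ), 3 ≤ M → 1 ≤ U → 1 ≤ Q₁ → Q₁ ≤ Q → Q ≤ M ^ d →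
    ∑ 𝔣 ∈ (idealsLE K Q).filter (fun 𝔣 => Q₁ < Ideal.absNorm 𝔣),
        (∑ χ ∈ primChars K 𝔣, ‖psiΩ K χ k M‖) / Nat.card ((𝓞 K ⧸ 𝔣)ˣ) ≤
      C * (Kmax ^ d * (1 + Real.log M) ^ rk * (idealsLE K Q).card * (Real.log U * (idealsLE K U).card) +
        G ^ d / M ^ d * ((U * Real.log U * (idealsLE K U).card) * (U * (idealsLE K U).card) +
          (d * Real.log M + Real.log U + d) * (U * (idealsLE K U).card)) * (Q ^ 2 * (idealsLE K Q).card) +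
        (∫ τ, ‖𝓕 (fun v => (k v : ℂ)) τ‖) ^ d * Real.log M ^ (rk + 3) * Real.sqrt (harmU K U ^ 3) *
          (Q * Real.sqrt (M ^ d) + M ^ d / Real.sqrt U + M ^ d / Q₁)) := by
  obtain ⟨Cg, hCg0, hCg⟩ := card_generators_box₀_le (K := K)
  obtain ⟨C₂, hC₂, hII⟩ := typeII_bound (K := K)
  have hcE := cErr_pos (K := K)
  refine ⟨max (max Cg (cErr K)) C₂ + 1, by positivity, ?_⟩
  intro k hhi hk2 hks2 hg3 hgs hg3' hgs' Kmax G hK hG0 hG hG' M U Q₁ Q hM hU hQ₁ hQ hQM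
  have hM1 : 1 ≤ M := by linarith
  have hM0 : 0 < M := by linarith
  have hQ1 : 1 ≤ Q := hQ₁.trans hQ
  have hQ0 : 0 ≤ Q := by linarith
  have hKmax : 0 ≤ Kmax := le_trans (abs_nonneg _) (hK 0)
  have hlogM : 0 ≤ Real.log M := Real.log_nonneg hM1
  have hlogU : 0 ≤ Real.log U := Real.log_nonneg hU
  -- the three bounds
  have hI := typeOne_bound (K := K) hhi hg3 hgs hg3' hgs' hG0 hG hG' hM1 hU hQ₁ Q
  have hk0 : ∀ v, 0 < v → (fun v => (k v : ℂ)) v = 0 := fun v hv => by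
    show (k v : ℂ) = 0; rw [hhi v hv.le, Complex.ofReal_zero]
  have hIIb := hII (fun v => (k v : ℂ)) hk2 hks2 hk0 M U Q₁ Q hM hU hQ₁ hQ hQM
  -- termwise decomposition `|ψ| ≤ |S₁| + (|S₂| + |S₃|) + |S₄|`
  have hdec : ∀ 𝔣 ∈ (idealsLE K Q).filter (fun 𝔣 => Q₁ < Ideal.absNorm 𝔣),
      (∑ χ ∈ primChars K 𝔣, ‖psiΩ K χ k M‖) / Nat.card ((𝓞 K ⧸ 𝔣)ˣ) ≤
        (∑ χ ∈ primChars K 𝔣, ‖S1 K χ k M U‖) / Nat.card ((𝓞 K ⧸ 𝔣)ˣ) +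
        (∑ χ ∈ primChars K 𝔣, (‖SmoothTypeOne.S2 K χ k M U‖ + ‖SmoothTypeOne.S3 K χ k M U‖)) / Nat.card ((𝓞 K ⧸ 𝔣)ˣ) +
        (∑ χ ∈ primChars K 𝔣, ‖S4total K χ (fun v => (k v : ℂ)) M U‖) / Nat.card ((𝓞 K ⧸ 𝔣)ˣ) := by
    intro 𝔣 _
    rw [← add_div, ← add_div, ← Finset.sum_add_distrib, ← Finset.sum_add_distrib]
    refine div_le_div_of_nonneg_right (Finset.sum_le_sum fun χ _ => ?_) (Nat.cast_nonneg _)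
    rw [psi_eq χ k M hU]
    calc ‖S1 K χ k M U - SmoothTypeOne.S2 K χ k M U + SmoothTypeOne.S3 K χ k M U - S4total K χ (fun v => (k v : ℂ)) M U‖
        ≤ ‖S1 K χ k M U - SmoothTypeOne.S2 K χ k M U + SmoothTypeOne.S3 K χ k M U‖ + ‖S4total K χ (fun v => (k v : ℂ)) M U‖ := norm_sub_le _ _
      _ ≤ (‖S1 K χ k M U - SmoothTypeOne.S2 K χ k M U‖ + ‖SmoothTypeOne.S3 K χ k M U‖) + ‖S4total K χ (fun v => (k v : ℂ)) M U‖ := by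
          gcongr; exact norm_add_le _ _
      _ ≤ (‖S1 K χ k M U‖ + ‖SmoothTypeOne.S2 K χ k M U‖ + ‖SmoothTypeOne.S3 K χ k M U‖) + ‖S4total K χ (fun v => (k v : ℂ)) M U‖ := by
          gcongr; exact norm_sub_le _ _
      _ = _ := by ring
  -- the `S₁` part
  have hS1 : ∀ 𝔣 ∈ (idealsLE K Q).filter (fun 𝔣 => Q₁ < Ideal.absNorm 𝔣),
      (∑ χ ∈ primChars K 𝔣, ‖S1 K χ k M U‖) / Nat.card ((𝓞 K ⧸ 𝔣)ˣ) ≤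
        Kmax ^ d * (Cg * (1 + Real.log M) ^ rk * (Real.log U * (idealsLE K U).card)) := by
    intro 𝔣 h𝔣
    rw [Finset.mem_filter, mem_idealsLE] at h𝔣
    have h𝔣0 := h𝔣.1.1
    have hφ : (0 : ℝ) < Nat.card ((𝓞 K ⧸ 𝔣)ˣ) := by
      haveI : Finite (𝓞 K ⧸ 𝔣) := Ideal.finiteQuotientOfFreeOfNeBot 𝔣 h𝔣0
      exact_mod_cast Nat.card_pos
    obtain ⟨B, hB⟩ : ∃ B : ℝ, B = Kmax ^ d * (Cg * (1 + Real.log M) ^ rk * (Real.log U * (idealsLE K U).card)) :=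
      ⟨_, rfl⟩
    rw [← hB]
    have hB0 : 0 ≤ B := by rw [hB]; positivity
    calc (∑ χ ∈ primChars K 𝔣, ‖S1 K χ k M U‖) / Nat.card ((𝓞 K ⧸ 𝔣)ˣ)
        ≤ ((primChars K 𝔣).card * B) / Nat.card ((𝓞 K ⧸ 𝔣)ˣ) := by
          refine div_le_div_of_nonneg_right ?_ hφ.le
          have hle : ∀ χ ∈ primChars K 𝔣, ‖S1 K χ k M U‖ ≤ B := fun χ _ => by
            rw [hB]; exact norm_S1_le hK hCg0 hCg hM1 hU h𝔣0 χ
          refine (Finset.sum_le_sum hle).trans (le_of_eq ?_)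
          rw [Finset.sum_const, nsmul_eq_mul]
      _ = ((primChars K 𝔣).card / Nat.card ((𝓞 K ⧸ 𝔣)ˣ)) * B := by ring
      _ ≤ 1 * B := mul_le_mul_of_nonneg_right ((div_le_one hφ).2 (card_primChars_le h𝔣0)) hB0
      _ = B := one_mul B
  -- sum the decomposition
  refine (Finset.sum_le_sum hdec).trans ?_
  rw [Finset.sum_add_distrib, Finset.sum_add_distrib]
  -- fold the three pieces
  obtain ⟨T₁, hT₁⟩ : ∃ T₁ : ℝ, T₁ = Kmax ^ d * (1 + Real.log M) ^ rk * (idealsLE K Q).card * (Real.log U * (idealsLE K U).card) :=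
    ⟨_, rfl⟩
  obtain ⟨T₂, hT₂⟩ : ∃ T₂ : ℝ, T₂ = G ^ d / M ^ d * ((U * Real.log U * (idealsLE K U).card) * (U * (idealsLE K U).card) +
      (d * Real.log M + Real.log U + d) * (U * (idealsLE K U).card)) * (Q ^ 2 * (idealsLE K Q).card) := ⟨_, rfl⟩
  obtain ⟨T₃, hT₃⟩ : ∃ T₃ : ℝ, T₃ = (∫ τ, ‖𝓕 (fun v => (k v : ℂ)) τ‖) ^ d * Real.log M ^ (rk + 3) *
      Real.sqrt (harmU K U ^ 3) * (Q * Real.sqrt (M ^ d) + M ^ d / Real.sqrt U + M ^ d / Q₁) := ⟨_, rfl⟩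
  rw [← hT₁, ← hT₂, ← hT₃]
  have hT₁0 : 0 ≤ T₁ := by rw [hT₁]; positivity
  have hT₂0 : 0 ≤ T₂ := by
    rw [hT₂]
    have : 0 ≤ d * Real.log M + Real.log U + d := by positivity
    positivity
  have hT₃0 : 0 ≤ T₃ := by
    rw [hT₃]
    have h1 : 0 ≤ (∫ τ, ‖𝓕 (fun v => (k v : ℂ)) τ‖) ^ d := pow_nonneg (integral_nonneg fun _ => norm_nonneg _) _
    have h2 : 0 ≤ Real.log M ^ (rk + 3) := pow_nonneg hlogM _
    positivity
  -- piece 1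
  have hP1 : ∑ 𝔣 ∈ (idealsLE K Q).filter (fun 𝔣 => Q₁ < Ideal.absNorm 𝔣),
      (∑ χ ∈ primChars K 𝔣, ‖S1 K χ k M U‖) / Nat.card ((𝓞 K ⧸ 𝔣)ˣ) ≤ Cg * T₁ := by
    refine (Finset.sum_le_sum hS1).trans ?_
    rw [Finset.sum_const, nsmul_eq_mul]
    have hcard : (((idealsLE K Q).filter (fun 𝔣 => Q₁ < Ideal.absNorm 𝔣)).card : ℝ) ≤ (idealsLE K Q).card := by
      exact_mod_cast Finset.card_le_card (Finset.filter_subset _ _)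
    have hB0 : 0 ≤ Kmax ^ d * (Cg * (1 + Real.log M) ^ rk * (Real.log U * (idealsLE K U).card)) := by positivity
    calc (((idealsLE K Q).filter (fun 𝔣 => Q₁ < Ideal.absNorm 𝔣)).card : ℝ) *
          (Kmax ^ d * (Cg * (1 + Real.log M) ^ rk * (Real.log U * (idealsLE K U).card)))
        ≤ (idealsLE K Q).card * (Kmax ^ d * (Cg * (1 + Real.log M) ^ rk * (Real.log U * (idealsLE K U).card))) :=
          mul_le_mul_of_nonneg_right hcard hB0
      _ = Cg * T₁ := by rw [hT₁]; ring
  -- piece 2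
  have hP2 : ∑ 𝔣 ∈ (idealsLE K Q).filter (fun 𝔣 => Q₁ < Ideal.absNorm 𝔣),
      (∑ χ ∈ primChars K 𝔣, (‖SmoothTypeOne.S2 K χ k M U‖ + ‖SmoothTypeOne.S3 K χ k M U‖)) / Nat.card ((𝓞 K ⧸ 𝔣)ˣ) ≤ cErr K * T₂ := by
    refine hI.trans ?_
    have h1 := sum_vonMangoldt_mul_absNorm_le (K := K) hU
    have h2 := sum_absNorm_le (K := K) U
    have h3 := sum_absNorm_sq_le (K := K) Q
    have hSΛ0 : 0 ≤ ∑ 𝔟 ∈ idealsLE K U, idealVonMangoldt 𝔟 * Ideal.absNorm 𝔟 :=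
      Finset.sum_nonneg fun 𝔟 _ => mul_nonneg (idealVonMangoldt_nonneg _) (Nat.cast_nonneg _)
    have hSU0 : 0 ≤ ∑ 𝔠 ∈ idealsLE K U, (Ideal.absNorm 𝔠 : ℝ) := Finset.sum_nonneg fun _ _ => Nat.cast_nonneg _
    have hLg0 : 0 ≤ d * Real.log M + Real.log U + d := by positivity
    have hUI : 0 ≤ U * (idealsLE K U).card := by positivity
    rw [hT₂]
    have hin : (∑ 𝔟 ∈ idealsLE K U, idealVonMangoldt 𝔟 * Ideal.absNorm 𝔟) * (∑ 𝔠 ∈ idealsLE K U, (Ideal.absNorm 𝔠 : ℝ)) +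
        (d * Real.log M + Real.log U + d) * ∑ 𝔟 ∈ idealsLE K U, (Ideal.absNorm 𝔟 : ℝ) ≤
        (U * Real.log U * (idealsLE K U).card) * (U * (idealsLE K U).card) +
          (d * Real.log M + Real.log U + d) * (U * (idealsLE K U).card) :=
      add_le_add (mul_le_mul h1 h2 hSU0 (by positivity)) (mul_le_mul_of_nonneg_left h2 hLg0)
    have hfac : 0 ≤ cErr K * G ^ d / M ^ d := by positivity
    calc cErr K * G ^ d / M ^ d *
          ((∑ 𝔟 ∈ idealsLE K U, idealVonMangoldt 𝔟 * Ideal.absNorm 𝔟) * (∑ 𝔠 ∈ idealsLE K U, (Ideal.absNorm 𝔠 : ℝ)) +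
            (d * Real.log M + Real.log U + d) * ∑ 𝔟 ∈ idealsLE K U, (Ideal.absNorm 𝔟 : ℝ)) *
          ∑ 𝔣 ∈ idealsLE K Q, (Ideal.absNorm 𝔣 : ℝ) ^ 2
        ≤ cErr K * G ^ d / M ^ d *
            ((U * Real.log U * (idealsLE K U).card) * (U * (idealsLE K U).card) +
              (d * Real.log M + Real.log U + d) * (U * (idealsLE K U).card)) * (Q ^ 2 * (idealsLE K Q).card) :=
          mul_le_mul (mul_le_mul_of_nonneg_left hin hfac) h3 (Finset.sum_nonneg fun _ _ => by positivity)
            (mul_nonneg hfac (by positivity))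
      _ = _ := by ring
  -- piece 3 is `hIIb`; assemble
  have hP3 : ∑ 𝔣 ∈ (idealsLE K Q).filter (fun 𝔣 => Q₁ < Ideal.absNorm 𝔣),
      (∑ χ ∈ primChars K 𝔣, ‖S4total K χ (fun v => (k v : ℂ)) M U‖) / Nat.card ((𝓞 K ⧸ 𝔣)ˣ) ≤ C₂ * T₃ :=
    hIIb.trans (le_of_eq (by rw [hT₃]; ring))
  have hCg' : Cg ≤ max (max Cg (cErr K)) C₂ + 1 := by
    have := le_max_left Cg (cErr K); have := le_max_left (max Cg (cErr K)) C₂; linarith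
  have hcE' : cErr K ≤ max (max Cg (cErr K)) C₂ + 1 := by
    have := le_max_right Cg (cErr K); have := le_max_left (max Cg (cErr K)) C₂; linarith
  have hC₂' : C₂ ≤ max (max Cg (cErr K)) C₂ + 1 := by
    have := le_max_right (max Cg (cErr K)) C₂; linarith
  calc ∑ 𝔣 ∈ (idealsLE K Q).filter (fun 𝔣 => Q₁ < Ideal.absNorm 𝔣),
          (∑ χ ∈ primChars K 𝔣, ‖S1 K χ k M U‖) / Nat.card ((𝓞 K ⧸ 𝔣)ˣ) +
        ∑ 𝔣 ∈ (idealsLE K Q).filter (fun 𝔣 => Q₁ < Ideal.absNorm 𝔣),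
          (∑ χ ∈ primChars K 𝔣, (‖SmoothTypeOne.S2 K χ k M U‖ + ‖SmoothTypeOne.S3 K χ k M U‖)) / Nat.card ((𝓞 K ⧸ 𝔣)ˣ) +
        ∑ 𝔣 ∈ (idealsLE K Q).filter (fun 𝔣 => Q₁ < Ideal.absNorm 𝔣),
          (∑ χ ∈ primChars K 𝔣, ‖S4total K χ (fun v => (k v : ℂ)) M U‖) / Nat.card ((𝓞 K ⧸ 𝔣)ˣ)
      ≤ Cg * T₁ + cErr K * T₂ + C₂ * T₃ := add_le_add (add_le_add hP1 hP2) hP3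
    _ ≤ (max (max Cg (cErr K)) C₂ + 1) * T₁ + (max (max Cg (cErr K)) C₂ + 1) * T₂ +
          (max (max Cg (cErr K)) C₂ + 1) * T₃ :=
        add_le_add (add_le_add (mul_le_mul_of_nonneg_right hCg' hT₁0) (mul_le_mul_of_nonneg_right hcE' hT₂0))
          (mul_le_mul_of_nonneg_right hC₂' hT₃0)
    _ = _ := by ring

end Literature.NumberTheory.Sieve.SmoothBVCore
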